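import Literature.Geometry.Symplectic.PlanarHomologySphereFillings
import Literature.Geometry.Symplectic.GirouxContactPathTube
import Literature.Geometry.Symplectic.SteinHandlebodies
import Literature.Topology.FourManifolds.MorseEulerEqualities
import Literature.Topology.FourManifolds.SPC4HandlesNormalFormProofs
import Literature.Topology.FourManifolds.MorseDiscLemma
import Literature.Geometry.Symplectic.PlanarMonodromyBinding
import Literature.Barriers.SmoothPoincare4.ExoticContractibleSymmetryKillingCore
import HarnessLib

/-!
# Oba 2016, Thm. 1.1 — the reachable steps of the printed proof (§3.1: handle decompositions of
# Stein fillings, Prop. 3.5; reduction of the fact to "at most one `1`-handle")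

Topic `Literature/Geometry/Symplectic`; sibling of `PlanarHomologySphereFillings.lean`, which holds
the named fact `Literature.Geometry.Symplectic.Oba2016_steinFilling_fourHoledSphere` (T. Oba, *Stein
fillings of homology `3`-spheres and mapping class groups*, Geom. Dedicata 183 (2016), 69–80,
arXiv:1407.5257, Thm. 1.1, special case of a contractible filling).  Everything here is PROVED; no
definition, no named fact.

Oba's proof of Thm. 1.1 (loc. cit., §3) runs: Wendl's theorem (every Stein filling of a planar
contact manifold is a positive allowable Lefschetz fibration over the given open book; Wendl 2010,
Thm. 1 = Oba's Thm. 1.3) ⟶ Kas' handle decomposition of a PALF with fibre `Σ_{0,n+1}` (one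
`0`-handle, `n` `1`-handles, one `2`-handle per singular fibre, §2.2) ⟶ **Prop. 3.5** (a handle
decomposition of the filling with one `0`-handle and no `3`- or `4`-handles has as many `1`-handles
as `2`-handles, because `χ(X) = 1`) ⟶ Prop. 3.6 (three singular fibres) ⟶ a case analysis of the
three vanishing cycles in `Σ_{0,4}`, Eliashberg's theorem on fillings of `S³` in cases (1)–(2), and
two handle cancellations in case (3).  Of these inputs only Prop. 3.5 is within reach of the tree
today (there is no Wendl theorem, no Kas handlebody of a PALF, no classification of simple closed
curves on the four-holed sphere, and `Eliashberg1990_steinFilling_sphere_three` is an undischarged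
named fact); it is proved here for the case the fact concerns — `W` contractible, so that Oba's
Lemmas 3.3–3.4 (`H₂(X; ℤ) = H₁(X; ℤ) = 0`) are automatic — from the tree's PROVED Morse equality for
compact manifolds with boundary
(`Literature.Topology.FourManifolds.IsMorseAdapted.finRelHomology_empty`, Matsumoto 2002,
Cor. 4.19) and `χ(contractible) = 1`
(`Literature.AlgebraicTopology.SingularHomology.relEuler_empty_of_contractibleSpace`):

* `Literature.Geometry.Symplectic.Oba2016_eulerCount_of_contractible` — for every handle
  decomposition `c` (`HasHandleDecomposition 3 W c`) of a compact contractible `4`-manifold with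
  boundary, `c₀ - c₁ + c₂ - c₃ + c₄ = 1`;
* `Literature.Geometry.Symplectic.Oba2016_prop35_of_contractible` — Prop. 3.5: `c₀ = 1`,
  `c₃ = c₄ = 0` imply `c₁ = c₂`;
* `Literature.Geometry.Symplectic.Oba2016_twoHandles_eq_three_of_contractible` — the count of
  Prop. 3.6: `c₀ = 1`, `c₁ = 3`, `c₃ = c₄ = 0` imply `c₂ = 3` (three singular fibres);
* `Literature.Geometry.Symplectic.Oba2016_steinFilling_fourHoledSphere_of_handles` — the fact
  follows from its HANDLE FORM (second disjunct for every such `W`), which is what the printed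
  proof delivers in all its cases; the `D⁴` branch needs no separate treatment (and `D⁴` has such a
  decomposition, `Literature.Topology.FourManifolds.hasHandleDecomposition_closedBall_four_oneOneOne`).

The standing set-up of Oba's §3.1 (*"the Stein filling `X` admits a handle decomposition without
`3`- or `4`-handles (see [El2] and [G])"*, with one `0`-handle as in Prop. 3.5) is moreover a
THEOREM for the tree's Stein domains, Gompf 1998, Thm. 1.3 (a) being PROVED in the tree
(`SteinStructure.isHandlebodyOfIndexLE_two`, `SteinHandlebodies.lean`) together with Milnor's
cancellation of surplus `0`-handles (Thm. 8.1 Index 0;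
`exists_isMorseAdapted_ncard_criticalSetOfIndex_zero_add_one_eq_holds`,
`SPC4HandlesNormalFormProofs.lean`) and the disc lemma (Milnor 1963, Thm. 3.1;
`HasHandleDecomposition.nonempty_diffeomorph_closedBall_of_handleCount_one_zero`,
`MorseDiscLemma.lean`), which gives the last section:

* `Literature.Geometry.Symplectic.SteinStructure.exists_hasHandleDecomposition_oneZeroHandle` —
  a compact connected Stein domain has a handle decomposition `c` with `c₀ = 1`, `cₖ = 0` (`k ≥ 3`);
* `Literature.Geometry.Symplectic.Oba2016_handles_of_contractible_stein` — a compact contractible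
  Stein domain has a handle decomposition `(1, m, m, 0, 0, …)` (Prop. 3.5, unconditional);
* `Literature.Geometry.Symplectic.Oba2016_steinFilling_fourHoledSphere_of_oneHandle_le_one` (and
  its Morse-function form `…_of_isMorseAdapted_ncard_one_le_one`) — **the fact reduces to "some
  handle decomposition with at most one `1`-handle and none of index `≥ 3`"** for the Stein domains
  it concerns (`c₁ = 0`: `W ≅ D⁴`, first disjunct; `c₁ = 1`: `(1, 1, 1, 0, …)`, second disjunct) —
  the residual content of Oba's proof being Wendl's PALF, Kas' `h⁰ ∪ 3h¹ ∪ 3h²` and the two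
  cancellations of `1`/`2` pairs.

Last section (review of the statement, 2026-08-17): **`ob.k = 4` counts binding TUBES, not binding
components.**  The tree's `OpenBook` (`PlanarContactBoundary.lean`) lets two tubes have the same
core (`OpenBook.range_core_eq_or_disjoint`, `OpenBook.reindex`, `GirouxContactPathTube.lean`), so an
open book with `k ≤ 4` tubes is re-presented with exactly `4` tubes by repeating one
(`OpenBook.exists_reindex_k_eq`: same binding, same fibration, same pages, planarity and Giroux
forms kept — `OpenBook.IsPlanar.reindex`, `OpenBook.Supports.reindex`), and conversely
`OpenBook.exists_reindex` keeps one tube per component.  Hence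

* `Literature.Geometry.Symplectic.Oba2016_steinFilling_fourHoledSphere_iff_k_le_four` — **the fact
  AS STATED is the statement for planar supporting open books with AT MOST four binding tubes**
  (equivalently at most four binding components; on the connected `∂W` the page is `Σ_{0,m}`,
  `1 ≤ m ≤ 4`), which is the form `ob.k ≤ 4` the route's planner note asks for.  This is still
  Oba's Thm. 1.1 as printed (page exactly `Σ_{0,4}`): an open book with page `Σ_{0,m}` supporting
  `ξ`, positively stabilised along an arc with both feet on one boundary circle, has page
  `Σ_{0,m+1}` and supports a contact structure isotopic to `ξ` (Etnyre 2006, Cor. 3.7 in the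
  arXiv:math/0409402 numbering; Gray stability turns the isotopy into a diffeomorphism carrying the
  stabilised open book to one supporting `ξ` itself), so `m ≤ 4` reduces to `m = 4`; alternatively
  the cases `m ≤ 3` are the easy sub-cases of Oba's own argument (Wendl's PALF has fibre `Σ_{0,m}`,
  `m - 1 ≤ 2` one-handles, and every homologically non-trivial curve on `Σ_{0,m}`, `m ≤ 3`, is a
  boundary curve, cancelling a `1`-handle).  What the tree still lacks for a discharge is unchanged:
  Wendl 2010, Thm. 1 (no declaration in the tree), Kas' handlebody of a PALF, the classification of
  homologically non-trivial simple closed curves on `Σ_{0,4}` and the two `1`/`2` cancellations in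
  Morse form; `supportedPlanarMonodromy` (`PlanarMonodromy.lean`) is the present-but-unproved
  reading of the monodromy.

The first step of the printed proof (*"According to Theorem 1.3 [Wendl] and Proposition 3.6, `X`
admits a PALF `f : X → D²` with fiber `Σ_{0,4}`"*) begins by READING the supporting open book as an
abstract planar open book `(P_n, φ)`; in the tree this is the cite fact
`Literature.Geometry.Symplectic.supportedPlanarMonodromy` (F-a, `PlanarMonodromy.lean`, Etnyre 2006
§2), consumed here as a hypothesis, and the last section records what it yields under the
hypotheses of the fact:

* `Literature.Geometry.Symplectic.Oba2016_planarMonodromy_of_supported` — **modulo F-a, the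
  boundary open book of the fact has a positively framed planar monodromy chart on `n + 1 ≤ ob.k`
  binding components** (so `n ≤ 3` for the four tubes of the fact): `∂W` is connected for
  contractible `W` (`Literature.Barriers.SmoothPoincare4.connectedSpace_boundaryCarrier_of_contractibleSpace`,
  Lefschetz duality), F-a re-tubes the book, and a monodromy chart pins the tubes to the binding
  components (`OpenBook.HasPlanarMonodromy.succ_le_k_of_binding_eq`, `PlanarMonodromyBinding.lean`);
* `Literature.Geometry.Symplectic.Oba2016_steinFilling_fourHoledSphere_of_supported_of_endgame` —
  **the fact follows from F-a together with the residual claim in the currency of the planned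
  Wendl fact** (`DictionaryDesign.md` §3, `Wendl2010Thm1Shape`): every compact contractible Stein
  domain whose boundary complex tangencies carry a Giroux form `α`, positively framed, with a planar
  monodromy chart on `n ≤ 3` holes, has a Morse function adapted to the boundary with at most one
  critical point of index `1` and all indices `≤ 2` — Wendl's PALF `X(P_n; A)`, `|A| = n` by
  `χ = 1`, and the two cancellations.

## References

* T. Oba, *Stein fillings of homology `3`-spheres and mapping class groups*, Geom. Dedicata 183
  (2016), 69–80 (arXiv:1407.5257), §3.1 (Lemma 3.3, Prop. 3.5, Prop. 3.6) and the proof of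
  Thm. 1.1, §3.2 (arXiv pp. 6–8). [Oba2016]
* R. E. Gompf, *Handlebody construction of Stein surfaces*, Ann. of Math. 148 (1998), 619–693,
  Thm. 1.3. [Gompf1998]
* J. Milnor, *Lectures on the h-cobordism theorem*, Princeton (1965), Thm. 8.1. [MilnorHCobordism1965]
* J. Milnor, *Morse theory*, Ann. of Math. Studies 51 (1963), Thm. 3.1. [Milnor1963]
* Y. Matsumoto, *An introduction to Morse theory*, AMS (2002), Cor. 4.19. [Matsumoto2001]
* J. B. Etnyre, *Lectures on open book decompositions and contact structures*, Clay Math. Proc. 5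
  (2006) (arXiv:math/0409402), Def. 2.7 and Cor. 3.7 of the arXiv numbering (positive
  stabilisation keeps the manifold and, up to isotopy, the supported contact structure); §2 and
  Def. 3.2 (monodromy, supporting open books). [Etnyre2006]
* C. Wendl, *Strongly fillable contact manifolds and `J`-holomorphic foliations*, Duke Math. J.
  151 (2010), 337–384 (arXiv:0806.3193), Thm. 1. [Wendl2010]
-/

noncomputable section

open scoped Manifold ContDiff Topology
open Literature.Topology.FourManifolds Literature.AlgebraicTopology.SingularHomology

namespace Literature.Geometry.Symplectic

universe u

/-- **The Euler count of a handle decomposition of a compact contractible `4`-manifold with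
boundary**: if `W` carries a Morse function adapted to `∂W` with `c k` critical points of index `k`
(`HasHandleDecomposition 3 W c`), then `c₀ - c₁ + c₂ - c₃ + c₄ = χ(W) = 1` — the computation
*"`1 = χ(X) = 1 - m + n`"* in the proof of Oba 2016, Prop. 3.5, written for all indices: the Morse
equality `χ(W) = Σₖ (-1)ᵏ cₖ` for compact manifolds with boundary (Matsumoto 2002, Cor. 4.19; the
tree's `IsMorseAdapted.finRelHomology_empty`) and `χ = 1` for a contractible space
(`relEuler_empty_of_contractibleSpace`). [cite: Oba2016, Prop. 3.5 (proof)] -/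
theorem Oba2016_eulerCount_of_contractible (W : Type u) [TopologicalSpace W] [T2Space W]
    [SecondCountableTopology W] [ChartedSpace (EuclideanHalfSpace 4) W] [IsManifold (𝓡∂ 4) ∞ W]
    [CompactSpace W] [ContractibleSpace W] {c : ℕ → ℕ} (h : HasHandleDecomposition 3 W c) :
    (c 0 : ℤ) - c 1 + c 2 - c 3 + c 4 = 1 := by
  obtain ⟨f, hf, hc⟩ := h
  -- the Morse equality `χ(W) = Σ_{k < 5} (-1)^k #crit_k(f)` with coefficients `ℤ`, and `χ(W) = 1`
  have hχ := (hf.finRelHomology_empty ℤ ℤ).2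
  rw [relEuler_empty_of_contractibleSpace ℤ ℤ, Module.finrank_self, Nat.cast_one, mul_one] at hχ
  norm_num [Finset.sum_range_succ, hc] at hχ
  linarith

/-- **Oba 2016, Prop. 3.5 (for a contractible filling).**  *"Let `M` be a homology `3`-sphere.
Suppose that a contact `3`-manifold `(M, ξ)` admits a Stein filling `X` and `ξ` is supported by a
planar open book decomposition.  Then, for any handle decomposition of `X` with one `0`-handle and
without `3`- or `4`-handles, the number of `1`-handles and that of `2`-handles agree."*  In the
paper the hypotheses serve only to give `H₂(X; ℤ) = H₁(X; ℤ) = 0` (Lemmas 3.3–3.4), whence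
`χ(X) = 1 = 1 - m + n`; for the CONTRACTIBLE fillings of
`Oba2016_steinFilling_fourHoledSphere` this vanishing is automatic and the content is the purely
Morse-theoretic statement proved here: a handle decomposition (`HasHandleDecomposition 3 W c`) of a
compact contractible `4`-manifold with boundary with one `0`-handle and no `3`- or `4`-handles has
equally many `1`- and `2`-handles.  (Combined with Kas' decomposition of a PALF with fibre
`Σ_{0,n+1}` — `n` `1`-handles, one `2`-handle per singular fibre — this is Oba's Prop. 3.6: `n`
singular fibres.)  -- TODO(general form): any Stein filling `X` of an integral homology sphere with
-- planar `ξ` (needs Lemmas 3.3–3.4: Etnyre 2004 Thm. 4.1, Ozsváth–Stipsicz–Szabó 2005).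
[cite: Oba2016, Prop. 3.5] -/
theorem Oba2016_prop35_of_contractible (W : Type u) [TopologicalSpace W] [T2Space W]
    [SecondCountableTopology W] [ChartedSpace (EuclideanHalfSpace 4) W] [IsManifold (𝓡∂ 4) ∞ W]
    [CompactSpace W] [ContractibleSpace W] {c : ℕ → ℕ} (h : HasHandleDecomposition 3 W c)
    (h₀ : c 0 = 1) (h₃ : c 3 = 0) (h₄ : c 4 = 0) : c 1 = c 2 := by
  have := Oba2016_eulerCount_of_contractible W h
  omega

/-- The count in the form used in the proof of Thm. 1.1 (via Prop. 3.6): a handle decomposition of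
a compact contractible `4`-manifold with one `0`-handle, three `1`-handles (Kas' `b₁(Σ_{0,4}) = 3`
one-handles of a PALF with fibre the four-holed sphere) and no `3`- or `4`-handles has exactly three
`2`-handles — *"the number of singular fibers of `f` is `n`"*, `n = 3`. [cite: Oba2016, Prop. 3.6] -/
theorem Oba2016_twoHandles_eq_three_of_contractible (W : Type u) [TopologicalSpace W] [T2Space W]
    [SecondCountableTopology W] [ChartedSpace (EuclideanHalfSpace 4) W] [IsManifold (𝓡∂ 4) ∞ W]
    [CompactSpace W] [ContractibleSpace W] {c : ℕ → ℕ} (h : HasHandleDecomposition 3 W c)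
    (h₀ : c 0 = 1) (h₁ : c 1 = 3) (h₃ : c 3 = 0) (h₄ : c 4 = 0) : c 2 = 3 := by
  have := Oba2016_eulerCount_of_contractible W h
  omega

/-! ### The handle form of the fact suffices (no separate `D⁴` branch)

In Oba's proof the dichotomy "`D⁴` or Mazur type" arises only at the very end: the PALF of the
filling always has the Kas decomposition `h⁰ ∪ 3h¹ ∪ 3h²`, two of whose `1`/`2` pairs cancel
(cases (1)–(3) of the proof of Thm. 1.1 alike), leaving `h⁰ ∪ h¹ ∪ h²`; the filling is then `D⁴`
exactly when the last pair cancels too, i.e. when `∂X ≅ S³` (Eliashberg).  For the tree's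
statement — whose conclusion is the DISJUNCTION "`W ≅ D⁴` or `W` has a handle decomposition
`(1, 1, 1, 0, …)`" — the second disjunct therefore always holds along the printed proof, and a
future discharge may aim at the handle form alone, with no appeal to Eliashberg's theorem on the
fillings of `S³` (`Literature.Geometry.Symplectic.Eliashberg1990_steinFilling_sphere_three`); the
`4`-ball itself has such a decomposition
(`Literature.Topology.FourManifolds.hasHandleDecomposition_closedBall_four_oneOneOne`,
`HandlePairInsertion.lean`). -/

/-- **Reduction of the fact to its handle form.**  If every compact contractible Stein domain whose
boundary complex tangencies are supported by a planar open book with four binding tubes carries a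
Morse function adapted to the boundary with exactly one critical point of each index `0, 1, 2` and
none of higher index, then `Oba2016_steinFilling_fourHoledSphere` holds (its second disjunct).
This is the form in which Oba's argument actually delivers the conclusion (Wendl's PALF, Kas'
decomposition `h⁰ ∪ 3h¹ ∪ 3h²` with three singular fibres by
`Oba2016_twoHandles_eq_three_of_contractible`, and two handle cancellations).
[cite: Oba2016, Thm. 1.1 (proof, §3.2)] -/
theorem Oba2016_steinFilling_fourHoledSphere_of_handles
    (h : ∀ (W : Type) [TopologicalSpace W] [T2Space W] [SecondCountableTopology W]
      [ChartedSpace (EuclideanHalfSpace 4) W] [IsManifold (𝓡∂ 4) ∞ W] [CompactSpace W]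
      [ContractibleSpace W] (S : SteinStructure W),
      (∃ (b : BoundaryData (𝓡∂ 4) W (𝓡 3)) (ob : OpenBook b.carrier),
          ob.IsPlanar ∧ ob.k = 4 ∧ ob.Supports (boundaryPlaneField S.J b)) →
      HasHandleDecomposition 3 W (fun k => if k ≤ 2 then 1 else 0)) :
    Oba2016_steinFilling_fourHoledSphere :=
  fun W _ _ _ _ _ _ _ S hS => Or.inr (h W S hS)

/-! ### Oba 2016, §3.1 — Stein domains have handle decompositions with one `0`-handle and no
`3`- or `4`-handles; the fact reduces to "at most one `1`-handle"

The standing set-up of Oba's §3.1 — *"It is well-known that the Stein filling `X` admits a handle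
decomposition without `3`- or `4`-handles (see [El2] and [G])"* (proof of Lemma 3.3), used with
*one* `0`-handle in Prop. 3.5 — is a THEOREM for the tree's Stein domains: Gompf 1998, Thm. 1.3
(Eliashberg 1990), "only if", condition (a), is PROVED in the tree
(`Literature.Geometry.Symplectic.SteinStructure.isHandlebodyOfIndexLE_two`, `SteinHandlebodies.lean`:
a Morse function adapted to `∂W` with all critical points of index `≤ 2`), and on a connected `W`
the surplus `0`-handles cancel against `1`-handles keeping every handle of index `≥ 2` (Milnor 1965,
Thm. 8.1 Index 0, PROVED in the tree as
`Literature.Topology.FourManifolds.exists_isMorseAdapted_ncard_criticalSetOfIndex_zero_add_one_eq_holds`,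
`SPC4HandlesNormalFormProofs.lean`).  Hence:

* `Literature.Geometry.Symplectic.SteinStructure.exists_hasHandleDecomposition_oneZeroHandle` —
  every compact connected Stein domain `(W, S)` has a handle decomposition `c` with `c₀ = 1` and
  `cₖ = 0` for `k ≥ 3`;
* `Literature.Geometry.Symplectic.Oba2016_handles_of_contractible_stein` — a compact CONTRACTIBLE
  Stein domain has a handle decomposition `(1, m, m, 0, 0, …)` for some `m` (Prop. 3.5, now
  unconditional: `Oba2016_prop35_of_contractible`);
* `Literature.Geometry.Symplectic.Oba2016_steinFilling_fourHoledSphere_of_oneHandle_le_one` —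
  **the fact reduces to "at most one `1`-handle"**: if every compact contractible Stein domain whose
  boundary complex tangencies are supported by a planar open book with four binding tubes has SOME
  handle decomposition with at most one `1`-handle and no handle of index `≥ 3` (any number of
  `0`- and `2`-handles), then `Oba2016_steinFilling_fourHoledSphere` holds — normalise to one
  `0`-handle, count `χ(W) = 1 = 1 - c₁ + c₂`, so `c₂ = c₁ ∈ {0, 1}`: `c₁ = 0` makes `W` a `4`-disc
  (first disjunct; Milnor 1963, Thm. 3.1 with the Lemma of Morse, the tree's PROVED
  `HasHandleDecomposition.nonempty_diffeomorph_closedBall_of_handleCount_one_zero`), `c₁ = 1` is the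
  handle count `(1, 1, 1, 0, …)` (second disjunct).  This is exactly the residual geometric content
  of Oba's proof of Thm. 1.1: Wendl's PALF with Kas' decomposition `h⁰ ∪ 3h¹ ∪ 3h²` and the TWO
  cancellations of `1`/`2` pairs of the Kirby diagram of Fig. 2 (case (3)), resp. of the boundary
  curves (cases (1)–(2)), leave one `1`-handle. -/

section SteinHandles

variable {n : ℕ} {V : Type u} [TopologicalSpace V] [T2Space V] [SecondCountableTopology V]
  [CompactSpace V] [ConnectedSpace V] [ChartedSpace (EuclideanHalfSpace (n + 1)) V]
  [IsManifold (𝓡∂ (n + 1)) ∞ V]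

/-- **Cancelling the surplus minima, keeping the count of every other index** (Milnor 1965,
Thm. 8.1 Index 0, *"a finite induction"*; Matsumoto 2002, proof of Thm. 3.35): on a compact
connected `(n+1)`-manifold with boundary, a Morse function adapted to the boundary with `r + 1`
critical points of index `0` can be replaced by one with a single critical point of index `0`,
`r` fewer critical points of index `1`, and as many critical points of each index `k ≥ 2` — the
tree's PROVED cancellation step
`Literature.Topology.FourManifolds.exists_isMorseAdapted_ncard_criticalSetOfIndex_zero_add_one_eq_holds`,
iterated (the variant of `Literature.Topology.FourManifolds.exists_isMorseAdapted_ncard_zero_eq_one_ncard_one_add`,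
`TrisectionsHandleCounts.lean`, without its hypothesis "no critical point of index `≥ 2`": the
counts of index `≥ 2` are KEPT rather than zero).
[cite: MilnorHCobordism1965, Thm. 8.1 Index 0 and its proof (PDF p. 54)] -/
theorem exists_isMorseAdapted_ncard_zero_eq_one_ncard_one_add_keep :
    ∀ (r : ℕ) (f : V → ℝ), IsMorseAdapted (𝓡∂ (n + 1)) f →
      (criticalSetOfIndex (𝓡∂ (n + 1)) f 0).ncard = r + 1 →
      ∃ g : V → ℝ, IsMorseAdapted (𝓡∂ (n + 1)) g ∧
        (criticalSetOfIndex (𝓡∂ (n + 1)) g 0).ncard = 1 ∧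
        (criticalSetOfIndex (𝓡∂ (n + 1)) g 1).ncard + r =
          (criticalSetOfIndex (𝓡∂ (n + 1)) f 1).ncard ∧
        ∀ k, 2 ≤ k → (criticalSetOfIndex (𝓡∂ (n + 1)) g k).ncard =
          (criticalSetOfIndex (𝓡∂ (n + 1)) f k).ncard := by
  intro r
  induction r with
  | zero =>
    intro f hf h0
    exact ⟨f, hf, h0, rfl, fun k _ => rfl⟩
  | succ r ih =>
    intro f hf h0
    obtain ⟨g₁, hg₁, h0₁, h1₁, hk₁⟩ :=
      exists_isMorseAdapted_ncard_criticalSetOfIndex_zero_add_one_eq_holds n V f hf (by omega)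
    obtain ⟨g, hg, h0g, h1g, hkg⟩ := ih g₁ hg₁ (by omega)
    exact ⟨g, hg, h0g, by omega, fun k hk => (hkg k hk).trans (hk₁ k hk)⟩

variable {W : Type u} [TopologicalSpace W] [T2Space W] [SecondCountableTopology W]
  [ChartedSpace (EuclideanHalfSpace 4) W] [IsManifold (𝓡∂ 4) ∞ W] [CompactSpace W]

/-- **A compact connected Stein domain has a handle decomposition with one `0`-handle and no
`3`- or `4`-handles** (Oba 2016, proof of Lemma 3.3: *"It is well-known that the Stein filling `X`
admits a handle decomposition without `3`- or `4`-handles (see [El2] and [G])"*, with the single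
`0`-handle of Prop. 3.5): Gompf 1998, Thm. 1.3 (a) (Eliashberg) gives a Morse function adapted to
`∂W` with all critical points of index `≤ 2` (`SteinStructure.isHandlebodyOfIndexLE_two`, PROVED),
and the surplus minima cancel against `1`-handles without touching the handles of index `≥ 2`
(Milnor 1965, Thm. 8.1 Index 0; `exists_isMorseAdapted_ncard_zero_eq_one_ncard_one_add_keep`).
[cite: Oba2016, Lemma 3.3 (proof) and Prop. 3.5] [cite: Gompf1998, Thm. 1.3 (compact case, only if, condition (a))]
[cite: MilnorHCobordism1965, Thm. 8.1 Index 0] -/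
theorem SteinStructure.exists_hasHandleDecomposition_oneZeroHandle [ConnectedSpace W]
    (S : SteinStructure W) :
    ∃ c : ℕ → ℕ, HasHandleDecomposition 3 W c ∧ c 0 = 1 ∧ ∀ k, 3 ≤ k → c k = 0 := by
  obtain ⟨f₀, hf₀, hidx⟩ := S.isHandlebodyOfIndexLE_two
  have hf₀' : IsMorseAdapted (𝓡∂ 4) f₀ := hf₀
  have hidx' : ∀ z, IsMCriticalPt (𝓡∂ 4) f₀ z → morseIndex (𝓡∂ 4) f₀ z ≤ 2 := hidx
  have hfin₀ : ∀ k, (criticalSetOfIndex (𝓡∂ 4) f₀ k).Finite := fun k =>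
    (IsMorse.finite_criticalSet_holds hf₀'.isMorse).subset (criticalSetOfIndex_subset _ f₀ k)
  -- no critical points of index `≥ 3`
  have h3₀ : ∀ k, 3 ≤ k → (criticalSetOfIndex (𝓡∂ 4) f₀ k).ncard = 0 := by
    intro k hk
    rw [Set.ncard_eq_zero (hfin₀ k)]
    refine Set.eq_empty_of_forall_notMem fun x hx => ?_
    have hle := hidx' x hx.1
    rw [hx.2] at hle
    omega
  -- at least one critical point of index `0`; cancel the others
  obtain ⟨r, hr⟩ : ∃ r, (criticalSetOfIndex (𝓡∂ 4) f₀ 0).ncard = r + 1 :=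
    ⟨(criticalSetOfIndex (𝓡∂ 4) f₀ 0).ncard - 1, by
      have := hf₀'.one_le_ncard_criticalSetOfIndex_zero; omega⟩
  obtain ⟨f, hf, hf0, -, hfk⟩ :=
    exists_isMorseAdapted_ncard_zero_eq_one_ncard_one_add_keep (n := 3) r f₀ hf₀' hr
  have hf' : IsMorseAdapted (𝓡∂ 4) f := hf
  have hf0' : (criticalSetOfIndex (𝓡∂ 4) f 0).ncard = 1 := hf0
  have hfk' : ∀ k, 2 ≤ k →
      (criticalSetOfIndex (𝓡∂ 4) f k).ncard = (criticalSetOfIndex (𝓡∂ 4) f₀ k).ncard := hfk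
  refine ⟨fun k => (criticalSetOfIndex (𝓡∂ 4) f k).ncard, ⟨f, hf', fun k => rfl⟩, hf0',
    fun k hk => ?_⟩
  show (criticalSetOfIndex (𝓡∂ 4) f k).ncard = 0
  rw [hfk' k (by omega)]
  exact h3₀ k hk

/-- **Oba 2016, Prop. 3.5, unconditional for the tree's contractible Stein domains**: a compact
contractible Stein domain has a handle decomposition with one `0`-handle, `m` `1`-handles, `m`
`2`-handles and no other handles, for some `m` — the decomposition of
`SteinStructure.exists_hasHandleDecomposition_oneZeroHandle` (Gompf Thm. 1.3 (a) + Milnor Thm. 8.1)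
has `c₁ = c₂` by `χ(W) = 1` (`Oba2016_prop35_of_contractible`).
[cite: Oba2016, Prop. 3.5] [cite: Gompf1998, Thm. 1.3 (compact case, only if, condition (a))] -/
theorem Oba2016_handles_of_contractible_stein [ContractibleSpace W] (S : SteinStructure W) :
    ∃ m : ℕ, HasHandleDecomposition 3 W (fun k => if k = 0 then 1 else if k ≤ 2 then m else 0) := by
  obtain ⟨c, hc, hc0, hc3⟩ := S.exists_hasHandleDecomposition_oneZeroHandle
  have h12 : c 1 = c 2 :=
    Oba2016_prop35_of_contractible W hc hc0 (hc3 3 le_rfl) (hc3 4 (by norm_num))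
  obtain ⟨f, hf, hcount⟩ := hc
  refine ⟨c 1, f, hf, fun k => ?_⟩
  rw [hcount k]
  show c k = if k = 0 then 1 else if k ≤ 2 then c 1 else 0
  rcases Nat.lt_or_ge k 3 with hk | hk
  · interval_cases k
    · rw [if_pos rfl, hc0]
    · rw [if_neg one_ne_zero, if_pos (by norm_num)]
    · rw [if_neg two_ne_zero, if_pos le_rfl, h12]
  · rw [if_neg (by omega), if_neg (by omega), hc3 k hk]

/-- **Reduction of the fact to "at most one `1`-handle".**  Suppose every compact contractible
Stein domain `(W, S)` whose boundary complex tangencies are supported by a planar open book with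
four binding tubes admits SOME handle decomposition (a Morse function adapted to `∂W`) with at most
one `1`-handle and no handle of index `≥ 3`.  Then `Oba2016_steinFilling_fourHoledSphere` holds:
`W` is connected and nonempty, so the surplus `0`-handles cancel against `1`-handles (Milnor 1965,
Thm. 8.1 Index 0; `exists_isMorseAdapted_ncard_zero_eq_one_ncard_one_add_keep`), leaving one `0`-handle,
`c₁ ≤ 1` one-handles, the same `2`-handles and nothing else; `χ(W) = 1` forces `c₂ = c₁`
(`Oba2016_prop35_of_contractible`); if `c₁ = 0` the decomposition is a single `0`-handle and
`W ≅ D⁴` (Milnor 1963, Thm. 3.1 with the Lemma of Morse: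
`HasHandleDecomposition.nonempty_diffeomorph_closedBall_of_handleCount_one_zero`) — the first
disjunct; if `c₁ = 1` it is the handle count `(1, 1, 1, 0, …)` — the second disjunct.  In Oba's
proof of Thm. 1.1 the hypothesis is met by Wendl's PALF over the given open book (Thm. 1.3) with
Kas' handle decomposition `h⁰ ∪ 3h¹ ∪ 3h²` (§2.2, Prop. 3.6) after the two cancellations of
`1`/`2`-handle pairs read off the vanishing cycles (boundary curves cancel the `1`-handle of their
binding component; in case (3) the Kirby diagram of Fig. 2 *"we can find two cancelling
`1`-handle/`2`-handle pairs in the diagram"*). [cite: Oba2016, Thm. 1.1 (proof, §3.2) and Prop. 3.5]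
[cite: MilnorHCobordism1965, Thm. 8.1 Index 0] [cite: Milnor1963, Thm. 3.1] -/
theorem Oba2016_steinFilling_fourHoledSphere_of_oneHandle_le_one
    (h : ∀ (W : Type) [TopologicalSpace W] [T2Space W] [SecondCountableTopology W]
      [ChartedSpace (EuclideanHalfSpace 4) W] [IsManifold (𝓡∂ 4) ∞ W] [CompactSpace W]
      [ContractibleSpace W] (S : SteinStructure W),
      (∃ (b : BoundaryData (𝓡∂ 4) W (𝓡 3)) (ob : OpenBook b.carrier),
          ob.IsPlanar ∧ ob.k = 4 ∧ ob.Supports (boundaryPlaneField S.J b)) →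
      ∃ c : ℕ → ℕ, HasHandleDecomposition 3 W c ∧ c 1 ≤ 1 ∧ ∀ k, 3 ≤ k → c k = 0) :
    Oba2016_steinFilling_fourHoledSphere := by
  intro W _ _ _ _ _ _ _ S hS
  obtain ⟨c, ⟨f₀, hf₀, hcount⟩, hc1, hc3⟩ := h W S hS
  have hf₀' : IsMorseAdapted (𝓡∂ 4) f₀ := hf₀
  have hcount' : ∀ k, (criticalSetOfIndex (𝓡∂ 4) f₀ k).ncard = c k := hcount
  -- normalise to a single `0`-handle, keeping the handles of index `≥ 2`
  obtain ⟨r, hr⟩ : ∃ r, (criticalSetOfIndex (𝓡∂ 4) f₀ 0).ncard = r + 1 :=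
    ⟨(criticalSetOfIndex (𝓡∂ 4) f₀ 0).ncard - 1, by
      have := hf₀'.one_le_ncard_criticalSetOfIndex_zero; omega⟩
  obtain ⟨f, hf, hf0, hf1, hfk⟩ :=
    exists_isMorseAdapted_ncard_zero_eq_one_ncard_one_add_keep (n := 3) r f₀ hf₀' hr
  have hf' : IsMorseAdapted (𝓡∂ 4) f := hf
  have hf0' : (criticalSetOfIndex (𝓡∂ 4) f 0).ncard = 1 := hf0
  have hf1' : (criticalSetOfIndex (𝓡∂ 4) f 1).ncard + r = (criticalSetOfIndex (𝓡∂ 4) f₀ 1).ncard :=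
    hf1
  have hfk' : ∀ k, 2 ≤ k →
      (criticalSetOfIndex (𝓡∂ 4) f k).ncard = (criticalSetOfIndex (𝓡∂ 4) f₀ k).ncard := hfk
  -- the counts of the normalised function
  have hd : HasHandleDecomposition 3 W fun k => (criticalSetOfIndex (𝓡∂ 4) f k).ncard :=
    ⟨f, hf', fun k => rfl⟩
  have hd3 : ∀ k, 3 ≤ k → (criticalSetOfIndex (𝓡∂ 4) f k).ncard = 0 := fun k hk => by
    rw [hfk' k (by omega), hcount' k]
    exact hc3 k hk
  have hd1 : (criticalSetOfIndex (𝓡∂ 4) f 1).ncard ≤ 1 := by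
    have := hcount' 1
    omega
  have h12 : (criticalSetOfIndex (𝓡∂ 4) f 1).ncard = (criticalSetOfIndex (𝓡∂ 4) f 2).ncard :=
    Oba2016_prop35_of_contractible W hd hf0' (hd3 3 le_rfl) (hd3 4 (by norm_num))
  rcases Nat.lt_or_ge (criticalSetOfIndex (𝓡∂ 4) f 1).ncard 1 with h0 | h1
  · -- no `1`-handle: a single `0`-handle, `W ≅ D⁴`
    left
    have hW : HasHandleDecomposition 3 W (handleCount 1 0) := by
      refine ⟨f, hf', fun k => ?_⟩
      show (criticalSetOfIndex (𝓡∂ 4) f k).ncard = handleCount 1 0 k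
      rcases Nat.lt_or_ge k 3 with hk | hk
      · interval_cases k
        · rw [handleCount_zero]; exact hf0'
        · rw [handleCount_one]; omega
        · rw [handleCount_of_two_le 1 0 le_rfl]; omega
      · rw [handleCount_of_two_le 1 0 (by omega)]; exact hd3 k hk
    exact hW.nonempty_diffeomorph_closedBall_of_handleCount_one_zero (by norm_num)
  · -- one `1`-handle: the handle count `(1, 1, 1, 0, …)`
    right
    refine ⟨f, hf', fun k => ?_⟩
    show (criticalSetOfIndex (𝓡∂ 4) f k).ncard = if k ≤ 2 then 1 else 0
    rcases Nat.lt_or_ge k 3 with hk | hk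
    · rw [if_pos (by omega)]
      interval_cases k
      · exact hf0'
      · omega
      · omega
    · rw [if_neg (by omega)]
      exact hd3 k hk

/-- The same reduction with the hypothesis read on a Morse function: it suffices that every such
`(W, S)` carry a Morse function adapted to `∂W` with at most one critical point of index `1` and
all critical points of index `≤ 2`. [cite: Oba2016, Thm. 1.1 (proof, §3.2)] -/
theorem Oba2016_steinFilling_fourHoledSphere_of_isMorseAdapted_ncard_one_le_one
    (h : ∀ (W : Type) [TopologicalSpace W] [T2Space W] [SecondCountableTopology W]
      [ChartedSpace (EuclideanHalfSpace 4) W] [IsManifold (𝓡∂ 4) ∞ W] [CompactSpace W]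
      [ContractibleSpace W] (S : SteinStructure W),
      (∃ (b : BoundaryData (𝓡∂ 4) W (𝓡 3)) (ob : OpenBook b.carrier),
          ob.IsPlanar ∧ ob.k = 4 ∧ ob.Supports (boundaryPlaneField S.J b)) →
      ∃ f : W → ℝ, IsMorseAdapted (𝓡∂ 4) f ∧ (criticalSetOfIndex (𝓡∂ 4) f 1).ncard ≤ 1 ∧
        ∀ z, IsMCriticalPt (𝓡∂ 4) f z → morseIndex (𝓡∂ 4) f z ≤ 2) :
    Oba2016_steinFilling_fourHoledSphere := by
  refine Oba2016_steinFilling_fourHoledSphere_of_oneHandle_le_one fun W _ _ _ _ _ _ _ S hS => ?_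
  obtain ⟨f, hf, h1, hidx⟩ := h W S hS
  have hfin : ∀ k, (criticalSetOfIndex (𝓡∂ 4) f k).Finite := fun k =>
    (IsMorse.finite_criticalSet_holds hf.isMorse).subset (criticalSetOfIndex_subset _ f k)
  refine ⟨fun k => (criticalSetOfIndex (𝓡∂ 4) f k).ncard, ⟨f, hf, fun k => rfl⟩, h1,
    fun k hk => ?_⟩
  show (criticalSetOfIndex (𝓡∂ 4) f k).ncard = 0
  rw [Set.ncard_eq_zero (hfin k)]
  refine Set.eq_empty_of_forall_notMem fun x hx => ?_
  have hle := hidx x hx.1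
  rw [hx.2] at hle
  omega

end SteinHandles

/-! ### `ob.k = 4` counts binding tubes: the fact is the statement for at most four binding
components

The tree's `OpenBook M` (`PlanarContactBoundary.lean`) is a family of `k` binding TUBES with the
fibration; its axioms make two cores coincide or be disjoint
(`OpenBook.range_core_eq_or_disjoint`) but do not forbid repeating a tube, and
`OpenBook.reindex` (`GirouxContactPathTube.lean`) re-presents the same binding and fibration on any
reindexing of the tubes whose cores still cover the binding.  Repeating a tube therefore PADS an
open book with `k ≤ m` tubes to one with exactly `m` tubes (`OpenBook.exists_reindex_k_eq`), with
the same pages (`OpenBook.reindex_page`), hence still planar (`OpenBook.IsPlanar.reindex`) and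
still supporting whatever it supported (`OpenBook.Supports.reindex`, from the tree's
`OpenBook.IsGirouxForm.reindex`).  Consequently the hypothesis
`∃ b ob, ob.IsPlanar ∧ ob.k = 4 ∧ ob.Supports ξ` of `Oba2016_steinFilling_fourHoledSphere` is
EQUIVALENT to the same with `ob.k ≤ 4`
(`Oba2016_steinFilling_fourHoledSphere_iff_k_le_four`): the fact speaks of planar supporting open
books with at most four binding components — pages `Σ_{0,m}`, `1 ≤ m ≤ 4`, on the connected `∂W` —
and not only of the page `Σ_{0,4}` of Oba's Thm. 1.1.  The statement is nevertheless the printed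
theorem: positive stabilisation along a boundary-parallel arc raises `m` by one, keeps genus `0`,
and supports a contact structure isotopic to the original one (Etnyre 2006, Def. 2.7 and Cor. 3.7,
arXiv numbering), so "supported by a planar open book with `≤ 4` binding components" implies
"supported by an open book with page `Σ_{0,4}`" — the hypothesis of Thm. 1.1 verbatim. -/

section Reindex

variable {M : Type u} [TopologicalSpace M] [ChartedSpace (EuclideanSpace ℝ (Fin 3)) M]
  [IsManifold (𝓡 3) ∞ M]

/-- **A reindexed open book has the same pages** (same binding, `OpenBook.reindex_binding`, and
the same fibration). [folklore] -/
theorem OpenBook.reindex_page (ob : OpenBook M) {k' : ℕ} (hk' : 0 < k') (f : Fin k' → Fin ob.k)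
    (hcover : ∀ j, ∃ a, Set.range (ob.core (f a)) = Set.range (ob.core j))
    (c : Metric.sphere (0 : EuclideanSpace ℝ (Fin 2)) 1) :
    (ob.reindex hk' f hcover).page c = ob.page c := by
  ext y
  rw [OpenBook.mem_page_iff, OpenBook.mem_page_iff, OpenBook.reindex_binding]
  rfl

/-- **Planarity is kept by reindexing the tubes** (the pages do not change). [folklore] -/
theorem OpenBook.IsPlanar.reindex {ob : OpenBook M} (h : ob.IsPlanar) {k' : ℕ} (hk' : 0 < k')
    (f : Fin k' → Fin ob.k) (hcover : ∀ j, ∃ a, Set.range (ob.core (f a)) = Set.range (ob.core j)) :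
    (ob.reindex hk' f hcover).IsPlanar := by
  intro c
  rw [OpenBook.reindex_page]
  exact h c

/-- **A supported plane field stays supported by the reindexed open book** (a Giroux form stays
one, `OpenBook.IsGirouxForm.reindex`). [folklore] -/
theorem OpenBook.Supports.reindex {ob : OpenBook M}
    {ξ : M → Submodule ℝ (EuclideanSpace ℝ (Fin 3))} (h : ob.Supports ξ) {k' : ℕ} (hk' : 0 < k')
    (f : Fin k' → Fin ob.k) (hcover : ∀ j, ∃ a, Set.range (ob.core (f a)) = Set.range (ob.core j)) :
    (ob.reindex hk' f hcover).Supports ξ := by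
  obtain ⟨α, hα⟩ := h
  exact ⟨α, hα.reindex hk' f hcover⟩

/-- **Padding the tubes**: an open book with `k ≤ m` tubes is re-presented (same binding, same
fibration, same pages) with exactly `m` tubes, by the reindexing `a ↦ min a (k - 1)` of
`Fin m → Fin k`, which repeats the last tube. [folklore] -/
theorem OpenBook.exists_reindex_k_eq (ob : OpenBook M) {m : ℕ} (hm : ob.k ≤ m) :
    ∃ (hm' : 0 < m) (f : Fin m → Fin ob.k)
      (hcover : ∀ j, ∃ a, Set.range (ob.core (f a)) = Set.range (ob.core j)),
      (ob.reindex hm' f hcover).k = m := by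
  have hk := ob.k_pos
  have hm' : 0 < m := lt_of_lt_of_le hk hm
  refine ⟨hm', fun a => ⟨min a.val (ob.k - 1), by omega⟩, fun j => ⟨⟨j.val, by omega⟩, ?_⟩, rfl⟩
  have hj : (⟨min j.val (ob.k - 1), by omega⟩ : Fin ob.k) = j := Fin.ext (by simp; omega)
  simp only [hj]

end Reindex

/-- **The fact as stated is the statement for at most four binding tubes.**
`Oba2016_steinFilling_fourHoledSphere` (hypothesis `ob.k = 4`) is equivalent to the same
statement with hypothesis `ob.k ≤ 4`: pad a planar supporting open book with `k ≤ 4` tubes to one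
with four tubes (`OpenBook.exists_reindex_k_eq`), which is still planar
(`OpenBook.IsPlanar.reindex`) and still supports the complex tangencies
(`OpenBook.Supports.reindex`).  So the fact concerns every compact contractible Stein domain whose
boundary complex tangencies are supported by a planar open book with AT MOST four binding
components (page `Σ_{0,m}`, `m ≤ 4`); by positive stabilisation (Etnyre 2006, Cor. 3.7, arXiv
numbering) this is still the hypothesis "page `Σ_{0,4}`" of Oba's Thm. 1.1.
[cite: Oba2016, Thm. 1.1] [cite: Etnyre2006, Def. 2.7 and Cor. 3.7 (arXiv numbering)] -/
theorem Oba2016_steinFilling_fourHoledSphere_iff_k_le_four :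
    Oba2016_steinFilling_fourHoledSphere ↔
    ∀ (W : Type) [TopologicalSpace W] [T2Space W] [SecondCountableTopology W]
      [ChartedSpace (EuclideanHalfSpace 4) W] [IsManifold (𝓡∂ 4) ∞ W] [CompactSpace W]
      [ContractibleSpace W] (S : SteinStructure W),
      (∃ (b : BoundaryData (𝓡∂ 4) W (𝓡 3)) (ob : OpenBook b.carrier),
          ob.IsPlanar ∧ ob.k ≤ 4 ∧ ob.Supports (boundaryPlaneField S.J b)) →
      Nonempty (W ≃ₘ⟮𝓡∂ 4, 𝓡∂ 4⟯ Metric.closedBall (0 : EuclideanSpace ℝ (Fin 4)) 1) ∨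
        HasHandleDecomposition 3 W (fun k => if k ≤ 2 then 1 else 0) := by
  constructor
  · intro h W _ _ _ _ _ _ _ S hS
    obtain ⟨b, ob, hpl, hk, hsupp⟩ := hS
    obtain ⟨h4, f, hcover, hk'⟩ := ob.exists_reindex_k_eq hk
    exact h W S ⟨b, ob.reindex h4 f hcover, hpl.reindex h4 f hcover, hk', hsupp.reindex h4 f hcover⟩
  · intro h W _ _ _ _ _ _ _ S hS
    obtain ⟨b, ob, hpl, hk, hsupp⟩ := hS
    exact h W S ⟨b, ob, hpl, hk.le, hsupp⟩

/-- **The fact, applied to a planar supporting open book with at most four binding tubes** (the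
form `ob.k ≤ 4` in which the route consumes it). [cite: Oba2016, Thm. 1.1] -/
theorem Oba2016_steinFilling_fourHoledSphere.of_k_le_four
    (h : Oba2016_steinFilling_fourHoledSphere) (W : Type) [TopologicalSpace W] [T2Space W]
    [SecondCountableTopology W] [ChartedSpace (EuclideanHalfSpace 4) W] [IsManifold (𝓡∂ 4) ∞ W]
    [CompactSpace W] [ContractibleSpace W] (S : SteinStructure W)
    (b : BoundaryData (𝓡∂ 4) W (𝓡 3)) (ob : OpenBook b.carrier) (hpl : ob.IsPlanar)
    (hk : ob.k ≤ 4) (hsupp : ob.Supports (boundaryPlaneField S.J b)) :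
    Nonempty (W ≃ₘ⟮𝓡∂ 4, 𝓡∂ 4⟯ Metric.closedBall (0 : EuclideanSpace ℝ (Fin 4)) 1) ∨
      HasHandleDecomposition 3 W (fun k => if k ≤ 2 then 1 else 0) :=
  Oba2016_steinFilling_fourHoledSphere_iff_k_le_four.1 h W S ⟨b, ob, hpl, hk, hsupp⟩

/-! ### The first step of the printed proof modulo F-a: the supporting open book read as `(P_n, φ)` with `n + 1 ≤ ob.k` -/

section Read

open Literature.Topology.FourManifolds.PlanarWords (ArcData)

/-- **Modulo F-a, the boundary open book of the fact has a positively framed planar monodromy chart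
on at most `ob.k` binding components.**  Let `(W, S)` be a compact contractible Stein domain, `b` a
boundary datum and `ob` a planar open book of `b.carrier ≅ ∂W` supporting the complex tangencies
`ξ_J = boundaryPlaneField S.J b`.  Then `∂W` is connected (Lefschetz duality for the contractible
`W`, `Literature.Barriers.SmoothPoincare4.connectedSpace_boundaryCarrier_of_contractibleSpace`), so
the cite fact `supportedPlanarMonodromy` (Etnyre 2006, §2: an open book is the relative mapping
torus of its monodromy off the binding; taken as the hypothesis `hFa`) re-tubes `ob` into an open
book `K` with the same fibration and binding, a Giroux form `α` for `ξ_J`, positively framed, and a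
planar monodromy chart `K.HasPlanarMonodromy n φ`; and the chart pins the `n + 1` tubes of `K` to
the `n + 1` binding COMPONENTS, of which `ob` has at most `ob.k`
(`OpenBook.HasPlanarMonodromy.succ_le_k_of_binding_eq`): `n + 1 ≤ ob.k`.  This is the reading
*"supported by an open book decomposition with page `Σ_{0,4}`"* ⟹ `(P_3, φ)` (or fewer holes, when
several of the four tubes share a binding component) with which Oba's proof of Thm. 1.1 starts
before invoking Wendl's theorem. [cite: Oba2016, Thm. 1.1 (proof, §3.2, first paragraph)]
[cite: Etnyre2006, §2 Lemma 2.3 (arXiv numbering) and Def. 3.2] -/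
theorem Oba2016_planarMonodromy_of_supported (hFa : supportedPlanarMonodromy)
    {W : Type} [TopologicalSpace W] [T2Space W] [SecondCountableTopology W]
    [ChartedSpace (EuclideanHalfSpace 4) W] [IsManifold (𝓡∂ 4) ∞ W] [CompactSpace W]
    [ContractibleSpace W] (S : SteinStructure W) (b : BoundaryData (𝓡∂ 4) W (𝓡 3))
    (ob : OpenBook b.carrier) (hpl : ob.IsPlanar) (hsup : ob.Supports (boundaryPlaneField S.J b)) :
    ∃ (K : OpenBook b.carrier) (α : Kaehler.MForm (𝓡 3) b.carrier ℝ 1) (n : ℕ) (φ : ArcData n),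
      n + 1 ≤ ob.k ∧ K.proj = ob.proj ∧ K.binding = ob.binding ∧
        K.IsGirouxForm (boundaryPlaneField S.J b) α ∧ IsPositivelyFramed K α ∧
        K.HasPlanarMonodromy n φ := by
  haveI : T2Space b.carrier := b.isSmoothEmbedding.isEmbedding.t2Space
  haveI : CompactSpace b.carrier := b.compactSpace_carrier
  haveI : ConnectedSpace b.carrier :=
    Literature.Barriers.SmoothPoincare4.connectedSpace_boundaryCarrier_of_contractibleSpace (n := 2) b
  obtain ⟨α, hα⟩ := hsup
  obtain ⟨K, n, φ, hproj, hbind, hG, hpos, hmono⟩ := hFa b.carrier ob _ α hpl hα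
  exact ⟨K, α, n, φ, hmono.succ_le_k_of_binding_eq hbind, hproj, hbind, hG, hpos, hmono⟩

/-- **The fact from F-a and the residual claim, stated in the currency of the planned Wendl fact.**
Suppose (`hFa`) `supportedPlanarMonodromy`, and (`hE`) that every compact contractible Stein domain
`(W, S)` with a boundary datum `b`, an open book `K` of `b.carrier` with a Giroux form `α` for
`ξ_J = boundaryPlaneField S.J b`, positively framed, and a planar monodromy chart
`K.HasPlanarMonodromy n φ` on `n ≤ 3` holes — exactly the input of Wendl's theorem as typed in the
vocabulary programme (`Wendl2010Thm1Shape`, DictionaryDesign.md §3), plus the bound on `n` — carries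
a Morse function adapted to `∂W` with at most one critical point of index `1` and all indices
`≤ 2`.  Then `Oba2016_steinFilling_fourHoledSphere` holds: read the book
(`Oba2016_planarMonodromy_of_supported`, `n + 1 ≤ ob.k = 4`), apply `hE`, and conclude by
`Oba2016_steinFilling_fourHoledSphere_of_isMorseAdapted_ncard_one_le_one`.  In Oba's proof `hE` is:
Wendl 2010, Thm. 1 (`W` is the PALF `X(P_n; A)` of a positive factorisation `A` of `φ`), Kas' handle
decomposition `h⁰ ∪ n h¹ ∪ |A| h²` with `|A| = n` by `χ(W) = 1` (Prop. 3.5–3.6;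
`Oba2016_eulerCount_of_contractible`), and the cancellation of two `1`/`2`-handle pairs along a
boundary curve and a standardised second curve (§3.2, case (3), Fig. 2; for `n ≤ 2` every vanishing
cycle is a boundary curve). [cite: Oba2016, Thm. 1.1 (proof, §3.2)] [cite: Wendl2010, Thm. 1] -/
theorem Oba2016_steinFilling_fourHoledSphere_of_supported_of_endgame (hFa : supportedPlanarMonodromy)
    (hE : ∀ (W : Type) [TopologicalSpace W] [T2Space W] [SecondCountableTopology W]
      [ChartedSpace (EuclideanHalfSpace 4) W] [IsManifold (𝓡∂ 4) ∞ W] [CompactSpace W]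
      [ContractibleSpace W] (S : SteinStructure W) (b : BoundaryData (𝓡∂ 4) W (𝓡 3))
      (K : OpenBook b.carrier) (α : Kaehler.MForm (𝓡 3) b.carrier ℝ 1) (n : ℕ) (φ : ArcData n),
      n ≤ 3 → K.IsGirouxForm (boundaryPlaneField S.J b) α → IsPositivelyFramed K α →
      K.HasPlanarMonodromy n φ →
      ∃ f : W → ℝ, IsMorseAdapted (𝓡∂ 4) f ∧ (criticalSetOfIndex (𝓡∂ 4) f 1).ncard ≤ 1 ∧
        ∀ z, IsMCriticalPt (𝓡∂ 4) f z → morseIndex (𝓡∂ 4) f z ≤ 2) :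
    Oba2016_steinFilling_fourHoledSphere := by
  refine Oba2016_steinFilling_fourHoledSphere_of_isMorseAdapted_ncard_one_le_one
    fun W _ _ _ _ _ _ _ S hS => ?_
  obtain ⟨b, ob, hpl, hk, hsup⟩ := hS
  obtain ⟨K, α, n, φ, hn, -, -, hG, hpos, hmono⟩ :=
    Oba2016_planarMonodromy_of_supported hFa S b ob hpl hsup
  exact hE W S b K α n φ (by omega) hG hpos hmono

end Read

end Literature.Geometry.Symplectic

end
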